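import Literature.MathematicalPhysics.QuantumFieldTheory.Balaban1983to89.Beta.RemainderOriginCoercive
import Literature.MathematicalPhysics.QuantumFieldTheory.Balaban1983to89.Beta.RemainderPrincipalCoercive

/-!
# Bałaban, *The variational problem and background fields in renormalization group method for lattice gauge
# theories*, Commun. Math. Phys. **102** (1985) 277–309 — the (190) letter of `(δ/δB)𝓗(0) = H₀ + G̃Δ⁽²⁾H₀` in a background
# FROM THE POSITIVITY AND LOCALITY OF `Δ_a` AND THE SURJECTIVITY OF `Q` ALONE (no propagator letter)

statement-level skeleton of published theorems with citation tags; proofs where landed; nothing here is a claim about the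
Yang–Mills mass gap (HONEST FRAMING, cell rule: discharging `BetaPertH` would make Bałaban's UV stability unconditional — a constructive-QFT
result; it is NOT the continuum limit and NOT the Clay problem; this module discharges NOTHING of `BetaPertH`).

CITATION HEADER (lean-in-tree rule 2026-08-18).  Source: T. Bałaban, Commun. Math. Phys. **102** (1985) 277–309,
doi:10.1007/BF01229381 [Balaban1985Variational] (cell paper B11 = [15]; held `paper:balaban1985-cmp102-variational-background`,
journal page = PDF page + 276): p. 297 after (128) *"Δ_a = Δ + DRD* + Q*aQ (the constant a = 1). For the operator Δ_a⁻¹ = G we have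
proved Theorem 3.3 in [5], and especially the bounds (3.42)"*, (129)–(131) pp. 297–298, p. 306 after (179), (180), (182) p. 307, (190)
p. 308; its ref. [5] = T. Bałaban, Commun. Math. Phys. **99** (1985) 389–434 [Balaban1985BackgroundPropagators] (B9): Thm 3.3 p. 399 with
(3.42) p. 397, Thm 3.11 p. 416 (*"the operators Δ′_a, G′, (Q′G′²Q′*)⁻¹, Δ_a, G are positive definite"*), (3.26)–(3.27) p. 395,
(3.132)–(3.133) p. 422, (3.137)–(3.138) p. 423; its ref. [3] = Commun. Math. Phys. **96** (1984) 223–250 [Balaban1984PropagatorsII] (B6)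
(2.51)–(2.56) pp. 232–233, Lemma 2.1 (2.61) p. 234; mechanism J.-M. Combes, L. Thomas, Commun. Math. Phys. **34** (1973) 251–270
[CombesThomas1973] §II.

WHY THIS FILE (audit cell `pub-balaban`, BINDER row (D4), OWNER lineage `b2b-balaban-beta-an4`, gen 107).  The END of the gen-107 pair
`Beta.RemainderPrincipalCoercive` (the letters) → this file (the composition into gen 106's `Beta.RemainderOriginCoercive`).  On the
carrier where the fields AND the sources of [15] Sect. G are real functions on one finite index set `m` (fine points × components) with
the sharp-block sup sizes of a block map `blk′ : m → 𝔅` (at most `N′` indices per block), the `Q`-images real functions on `n` (coarse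
points × components) with the sharp-block sup sizes of `blk : n → 𝔅` (at most `N` per block), and the B-data an abstract block-normed
space: the (190) letter of NODE D at the origin, `Ineq190 bB (ofBlocks blk′) (H₀ + G̃Δ⁽²⁾H₀) C δ`, follows from THREE INVERSE-FREE
LETTERS about Bałaban's one-step bond operator `Δ_a = Δ_U + DRD* + Q*Q` (a real matrix `Δ` on `m`) and averaging operator `Q` (a real
matrix `n × m`): **(A1)** `Δ` symmetric and `γ_a`-coercive, `γ_a > 0` ([5] Thm 3.11); **(A2)** the entry decay
`|Δ(i,j)| ≤ C_ae^{−δ_ad(blk′ i, blk′ j)}` (localisation: automatic for the finite-range parts `Δ_U`, `Q*Q` —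
`RemainderPrincipalCoercive.abs_entry_le_exp_of_range`; for `DR(U)D*` the kernel decay of the projection `R(U)` onto `Δ_UN(Q′)` (3.21),
a SITE-operator statement of the type [5] Thms 3.1–3.2, the NE9 programme's objects); **(A4)** `QQᵀ` is `c_Q`-coercive (surjectivity
of the averaging operator) — everything else being structure exactly as in
`RemainderOriginCoercive.ineq190_origin_of_coercive`: `G₀ := Δ⁻¹` (the matrix inverse, a two-sided inverse by coercivity),
`Q* := Qᵀ`, `S := QΔ⁻¹Qᵀ`, `H₀ = G₀Q*S⁻¹J` ((129)), `Δ⁽²⁾`, `Q`, `Q*`, `J` local in block currency, the resolvent identities of the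
new `G′` and of `(QG′Q*)⁻¹` with a priori bounds, `G̃ = G′ − G′Q*(QG′Q*)⁻¹QG′`, the pseudo-metric and row-sum bookkeeping (2.54)/(2.61),
and the rates: the Combes–Thomas rate of `G₀` ITSELF is born here — `δ₁ + τ_a + σ ≤ δ_a`, `ρ_a = C_aδ₁τ_a⁻¹N′c < γ_a`,
`B = N′(γ_a − ρ_a)⁻¹` (the (3.42)₀ pair `(B, δ₁)` DERIVED) — then gen 106's `κ + τ + σ ≤ δ₁`, `ρ_S = C_Sκτ⁻¹Nc < γ := c_Q/Λ`,
`Λ = C_aN′c > 0` (the coercivity of `QG₀Q*` DERIVED), `ρ + 5σ ≤ κ`, `δ/8 ≤ ρ`, `q, q_I < 1`.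
* **`ineq190_origin_of_principal`** — the composition: `hG0 := RemainderInvQGQCoercive.hasMaj_inv_of_coercive_decay` applied to
  `S := Δ` with (A1)+(A2); `hco := RemainderPrincipalCoercive.qgq_coercive_of_letters` from (A1)+(A2)+(A4); both into
  `RemainderOriginCoercive.ineq190_origin_of_coercive` with `F3 = FA = (m → ℝ)`, `b3 = bN = ofBlocks blk′` (`κ = 1`).
LETTER LIST OF NODE D AT THE ORIGIN IN A BACKGROUND after this file (analytic, FIXED lattice): (A1) positivity + (A2) localisation of
Bałaban's bond operator (non-automatic part: the decay of `R(U)`, [5] Thms 3.1–3.2 for the SITE operators) + (A4) surjectivity of his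
averaging operator — no BOND-propagator statement ([5] Thm 3.3, (3.132), (3.133)) remains; carrier = NODE O (Bałaban's step objects as terms; ownerless,
FROZEN (0); the NE9 chain's `B9Thm311SmallFieldCoercivity.exists_coercive_principal_of_small_field` is (A1) for ITS bond operator at a
fixed lattice, on a complex Hilbert carrier — the real-matrix read-out is not done here).

HONEST SCOPE.  Plumbing only ([folklore] composition); NO estimate of [5] or [15] is proved; constants of a FIXED lattice (`γ_a`, `Λ`,
`δ₁ < γ_aτ_a(C_aN′c)⁻¹`, `B = N′(γ_a − ρ_a)⁻¹` and `γ = c_Q/Λ` all degrade with the fine points per block): the k-UNIFORM (3.42) ([5]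
Thm 3.3, the multiscale random walk of Sect. D; for the coercivity of `QG₀Q*` the in-block plateau reconstruction of the row's interface
item (I3)/E-I3, `Summit.QuantumFields.BalabanUV.Beta.CoarseCoercive*`, this lineage gens 39 ff.) is NOT reproduced and remains the row's
located analytic input for k-uniform constants; fields and sources share ONE sup-size block norm (the (L^jη)-weights of (190)'s entries
and of (3.132) not reproduced); `Q* = Qᵀ`.  Row (D4) class UNCHANGED (instance 0∕1; D4 DISCHARGE
NO DATE); NOT B12 Thm 2, NOT BetaPertH, NOT continuum, NOT Clay.  HONEST DEPENDENCY (cell line): continuum YM on T⁴ ⇐ BetaPertH ∧ nine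
spine estimates (0/9 proved); BetaPertH ⇐ (D1) ∧ (D4) ∧ CAP+tail; G-an2-4 gates asym, D1 and NE2/3/4.  NEW file; nothing modified;
0 `def`; standard axioms; no `sorry`.
-/

namespace Literature.MathematicalPhysics.QuantumFieldTheory.Balaban1983to89.Beta.RemainderOriginPrincipal

open Literature.MathematicalPhysics.QuantumFieldTheory.Balaban1983to89
open Finset Matrix B6RandomWalk B11SectG B11Reparam190
open Beta.RemainderOriginCoercive Beta.RemainderInvQGQCoercive Beta.RemainderPrincipalCoercive

variable {g : B6.Geometry}

variable {n m : Type} [Fintype n] [DecidableEq n] [Fintype m] [DecidableEq m]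
  {FB : Type} [AddCommGroup FB] [Module ℝ FB]

/-- **NODE D OF ROW (D4) AT THE ORIGIN, IN A BACKGROUND, FROM THE POSITIVITY AND LOCALITY OF `Δ_a` AND THE SURJECTIVITY OF `Q`.**
Fields = sources = `m → ℝ` (sharp-block sup sizes of `blk′`, at most `N′` indices per block), `Q`-images = `n → ℝ` (sharp-block sup
sizes of `blk`, at most `N` per block), B-data `FB` (size `bB`) abstract.  ANALYTIC INPUTS, ALL INVERSE-FREE: `hsymm`, `hcoΔ` — `Δ`
symmetric and `γ_a`-coercive, `γ_a > 0` ([5] Thm 3.11); `hSΔ` — `|Δ(i,j)| ≤ C_ae^{−δ_ad(blk′ i, blk′ j)}`, `C_a ≥ 0` (localisation;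
for `DR(U)D*` the decay of `R(U)` (3.21));
`hQQ` — `QQᵀ` `c_Q`-coercive.  DERIVED INSIDE: `G₀ := Δ⁻¹` has the block majorant `Be^{−δ₁d}`, `B = N′(γ_a − ρ_a)⁻¹`, for
`δ₁ ≥ 0`, `τ_a > 0`, `δ₁ + τ_a + σ ≤ δ_a`, `ρ_a = C_aδ₁τ_a⁻¹N′c < γ_a` ([5] (3.42)₀ at a fixed lattice, Combes–Thomas); `S := QΔ⁻¹Qᵀ` is
`γ`-coercive, `γ = c_Q/Λ`, `Λ = C_aN′c > 0` (variational principle).  STRUCTURE (as in `RemainderOriginCoercive.ineq190_origin_of_coercive`,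
with `G₀ = Δ⁻¹`, `Q`, `Q* = Qᵀ` the matrices as maps): `J : FB → (n → ℝ)`, `Δ⁽²⁾ : (m → ℝ) → (m → ℝ)` LOCAL; `H₀ = G₀Q*·S⁻¹·J`;
`G′ = G₀ + G₀Δ⁽²⁾G′`, `Inv′ = S⁻¹ − S⁻¹(QG₀Δ⁽²⁾G′Q*)Inv′` a priori bounded; `G̃ = G′ − G′Q*·Inv′·QG′`; rates `κ ≥ 0`, `τ > 0`,
`κ + τ + σ ≤ δ₁`, `ρ + 5σ ≤ κ`, `δ/8 ≤ ρ`; smallnesses `ρ_S = C_Sκτ⁻¹Nc < γ`, `q = Bλe^{δ₁r_D}c < 1`, `q_I = B_Iθ_Pc² < 1`.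
CONCLUSION: `Ineq190 bB (ofBlocks blk′) (H₀ + G̃Δ⁽²⁾H₀) (A₀ + B_G̃θ_Dc) δ`, constants in closed form (instantiate the `h…` with `rfl`).
[cite: Balaban1985Variational, (129)–(131) pp.297–298, p.306 after (179), (180) p.306, (182) p.307, (190) p.308; Balaban1985BackgroundPropagators, Thm 3.11 p.416, Thm 3.3 (3.42) p.397+p.399, (3.26)–(3.27) p.395, (3.132)–(3.133) p.422, (3.137)–(3.138) p.423; Balaban1984PropagatorsII, (2.51)–(2.54) pp.232–233, Lemma 2.1 (2.61) p.234; CombesThomas1973, §II] -/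
theorem ineq190_origin_of_principal (blk : n → g.Site) (blk' : m → g.Site) (Δ : Matrix m m ℝ) (Qm : Matrix n m ℝ)
    {bB : BlockNorm g FB}
    {H0 : FB →ₗ[ℝ] (m → ℝ)} {D2 : (m → ℝ) →ₗ[ℝ] (m → ℝ)} {G0 G' Gt : (m → ℝ) →ₗ[ℝ] (m → ℝ)}
    {Q : (m → ℝ) →ₗ[ℝ] (n → ℝ)} {Qs : (n → ℝ) →ₗ[ℝ] (m → ℝ)}
    {Inv' : (n → ℝ) →ₗ[ℝ] (n → ℝ)} {J : FB →ₗ[ℝ] (n → ℝ)} {S : Matrix n n ℝ} {KD KQ KQs KJ : g.Site → g.Site → ℝ}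
    {N N' : ℕ} {γa Ca δa τa ρa cQ Λ γ B δ₁ κ τ ρS CS BI M₀ MI lam rD νQ νs rQ νJ rJ ρ σ c A₀ θD q BG' θP qI BI' BGt δ : ℝ}
    -- geometry
    (htri : Triangle254 g) (hd : ∀ a b : g.Site, 0 ≤ g.dist a b) (hds : ∀ a b : g.Site, g.dist a b = g.dist b a)
    (hd0 : ∀ a : g.Site, g.dist a a = 0) (hrow : RowSum g σ c) (hc : 0 ≤ c)
    (hN : ∀ y : g.Site, ∃ s : Finset n, s.card ≤ N ∧ ∀ j, blk j = y → j ∈ s)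
    (hN' : ∀ y : g.Site, ∃ s : Finset m, s.card ≤ N' ∧ ∀ j, blk' j = y → j ∈ s)
    -- THE THREE INVERSE-FREE LETTERS: (A1) positivity, (A2) locality of Δ_a; (A4) surjectivity of Q
    (hsymm : Δ.IsSymm) (hγa : 0 < γa) (hcoΔ : QGQInverse.Coercive Δ γa) (hCa : 0 ≤ Ca)
    (hSΔ : ∀ i j, |Δ i j| ≤ Ca * Real.exp (-(δa * g.dist (blk' i) (blk' j))))
    (hQQ : QGQInverse.Coercive (Qm * Qmᵀ) cQ)
    -- the objects as maps
    (hG0def : G0 = Matrix.toLin' Δ⁻¹) (hQdef : Q = Matrix.toLin' Qm) (hQsdef : Qs = Matrix.toLin' Qmᵀ)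
    (hSdef : S = Qm * Δ⁻¹ * Qmᵀ)
    -- the Combes–Thomas rate δ₁ of G₀ (DERIVED (3.42)₀ pair (B, δ₁)) and the DERIVED coercivity γ of S
    (hσ : 0 ≤ σ) (hδ₁ : 0 ≤ δ₁) (hτa : 0 < τa) (hratea : δ₁ + τa + σ ≤ δa)
    (hρa : ρa = Ca * δ₁ / τa * N' * c) (hρaγ : ρa < γa) (hBdef : B = N' * (γa - ρa)⁻¹)
    (hΛ : Λ = Ca * N' * c) (hΛ0 : 0 < Λ) (hγ : γ = cQ / Λ)
    -- gen 106's rates and smallnesses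
    (hρ : 0 ≤ ρ) (hκ : 0 ≤ κ) (hτ : 0 < τ) (hrate : κ + τ + σ ≤ δ₁) (hρκ : ρ + 5 * σ ≤ κ) (hδ : δ / 8 ≤ ρ)
    (hM₀ : 0 ≤ M₀) (hMI : 0 ≤ MI) (hlam : 0 ≤ lam) (hνQ : 0 ≤ νQ) (hνs : 0 ≤ νs) (hνJ : 0 ≤ νJ)
    (hCS : CS = B * νQ * Real.exp (δ₁ * rQ) * νs * Real.exp (δ₁ * rQ))
    (hρS : ρS = CS * κ / τ * N * c) (hρSγ : ρS < γ) (hBI : BI = N * (γ - ρS)⁻¹)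
    -- H₀ = G₀Q*(QG₀Q*)⁻¹J with J local
    (hH0def : H0 = ((G0 ∘ₗ Qs) ∘ₗ Matrix.toLin' S⁻¹) ∘ₗ J)
    (hKJ : ∀ a b, 0 ≤ KJ a b) (hJloc : ∀ a b, KJ a b ≠ 0 → g.dist a b ≤ rJ)
    (hJcol : ∀ b, ∑ a : g.Site, KJ a b ≤ νJ) (hJ : HasMaj bB (BlockNorm.ofBlocks g blk) J KJ)
    -- Δ⁽²⁾ local
    (hKD : ∀ a b, 0 ≤ KD a b) (hDloc : ∀ a b, KD a b ≠ 0 → g.dist a b ≤ rD)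
    (hDrow : ∀ a, ∑ b : g.Site, KD a b ≤ lam) (hDcol : ∀ b, ∑ a : g.Site, KD a b ≤ lam)
    (hD2 : HasMaj (BlockNorm.ofBlocks g blk') (BlockNorm.ofBlocks g blk') D2 KD)
    -- the new G′
    (hfix : G' = G0 + (G0 ∘ₗ D2) ∘ₗ G') (hap : HasMaj (BlockNorm.ofBlocks g blk') (BlockNorm.ofBlocks g blk') G' (fun _ _ => M₀))
    (hq_def : q = B * lam * Real.exp (δ₁ * rD) * c) (hq : q < 1) (hBG' : BG' = B * (1 - q)⁻¹)
    -- Q, Q* local in block currency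
    (hKQ : ∀ a b, 0 ≤ KQ a b) (hQloc : ∀ a b, KQ a b ≠ 0 → g.dist a b ≤ rQ)
    (hQrow : ∀ a, ∑ b : g.Site, KQ a b ≤ νQ) (hQ : HasMaj (BlockNorm.ofBlocks g blk') (BlockNorm.ofBlocks g blk) Q KQ)
    (hKQs : ∀ a b, 0 ≤ KQs a b) (hQsloc : ∀ a b, KQs a b ≠ 0 → g.dist a b ≤ rQ)
    (hQscol : ∀ b, ∑ a : g.Site, KQs a b ≤ νs) (hQs : HasMaj (BlockNorm.ofBlocks g blk) (BlockNorm.ofBlocks g blk') Qs KQs)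
    -- (QG′Q*)⁻¹: second resolvent identity, a priori bound, smallness
    (hfixI : Inv' = Matrix.toLin' S⁻¹ -
      (Matrix.toLin' S⁻¹ ∘ₗ (Q ∘ₗ (((G0 ∘ₗ D2) ∘ₗ G') ∘ₗ Qs))) ∘ₗ Inv')
    (hapI : HasMaj (BlockNorm.ofBlocks g blk) (BlockNorm.ofBlocks g blk) Inv' (fun _ _ => MI))
    (hθP : θP = (B * lam * Real.exp (δ₁ * rD) * BG' * c) * νs * Real.exp ((ρ + 4 * σ) * rQ) * νQ *
      Real.exp ((ρ + 4 * σ) * rQ))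
    (hqI : qI = BI * θP * c * c) (hqI1 : qI < 1) (hBI' : BI' = BI * (1 - qI)⁻¹)
    -- G̃ = G′P₀′*
    (hGt : Gt = G' - (G' ∘ₗ Qs) ∘ₗ Inv' ∘ₗ (Q ∘ₗ G'))
    -- derived constants
    (hA₀ : A₀ = (B * νs * Real.exp (δ₁ * rQ)) * (BI * νJ * Real.exp (κ * rJ)) * c)
    (hθD : θD = A₀ * lam * Real.exp (ρ * rD))
    (hBGt : BGt = BG' + νQ * νs * BI' * BG' * BG' * Real.exp ((ρ + 2 * σ) * rQ) * Real.exp ((ρ + 2 * σ) * rQ) * c * c) :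
    Ineq190 bB (BlockNorm.ofBlocks g blk') (H0 + Gt ∘ₗ (D2 ∘ₗ H0)) (A₀ + BGt * θD * c) δ := by
  subst hG0def hQdef hQsdef
  have hκ1 : (BlockNorm.ofBlocks g blk' : BlockNorm g (m → ℝ)).κ = 1 := rfl
  -- (3.42)₀ at a fixed lattice: the block majorant of G₀ = Δ⁻¹ from (A1) + (A2) (finite Combes–Thomas, V78 §3 applied to S := Δ)
  have hG0 : HasMaj (BlockNorm.ofBlocks g blk') (BlockNorm.ofBlocks g blk') (Matrix.toLin' Δ⁻¹)
      (fun a b => B * Real.exp (-(δ₁ * g.dist a b))) := by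
    rw [hBdef]
    exact hasMaj_inv_of_coercive_decay blk' Δ hd hds hd0 htri hrow hCa hδ₁ hτa hratea hN' hcoΔ hSΔ hρa hρaγ
  have hB : 0 ≤ B := by
    rw [hBdef]; exact mul_nonneg (Nat.cast_nonneg N') (inv_nonneg.mpr (by linarith))
  -- the coercivity of S = QΔ⁻¹Qᵀ from (A1) + (A2) + (A4) (Schur form bound + variational principle, the sibling's §4)
  have hσδa : σ ≤ δa := by linarith
  have hco : QGQInverse.Coercive S γ := by
    rw [hSdef, hγ]
    exact qgq_coercive_of_letters blk' Δ Qm hd hds hrow hσδa hCa hN' hsymm hγa hcoΔ hSΔ hQQ hΛ hΛ0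
  have hSdef' : S = LinearMap.toMatrix' ((Matrix.toLin' Qm ∘ₗ Matrix.toLin' Δ⁻¹) ∘ₗ Matrix.toLin' Qmᵀ) := by
    rw [← Matrix.toLin'_mul, ← Matrix.toLin'_mul, LinearMap.toMatrix'_toLin', hSdef]
  have h := ineq190_origin_of_coercive blk htri hd hds hd0 hrow hc hN hσ hρ hκ hτ hrate hρκ hδ hB hM₀ hMI hlam hνQ hνs hνJ
    hG0 hSdef' hco (CS := CS) ?_ hρS hρSγ hBI hH0def hKJ hJloc hJcol hJ hKD hDloc hDrow hDcol hD2 hfix hap (q := q) ?_ hq hBG'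
    hKQ hQloc hQrow hQ hKQs hQsloc hQscol hQs hfixI hapI (θP := θP) ?_ hqI hqI1 hBI' hGt (A₀ := A₀) ?_ (θD := θD) ?_
    (BGt := BGt) ?_
  · rw [hκ1, one_mul] at h; exact h
  · rw [hCS, hκ1]; ring
  · rw [hq_def, hκ1]; ring
  · rw [hθP, hκ1]; ring
  · rw [hA₀, hκ1]; ring
  · rw [hθD, hκ1]; ring
  · rw [hBGt, hκ1]; ring

end Literature.MathematicalPhysics.QuantumFieldTheory.Balaban1983to89.Beta.RemainderOriginPrincipal
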